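import Summits.Parity.GeneralizedHardyLittlewood.Theorems.Dhl42TablesMono

/-!
# DHL[42,2] certificate — `StaircaseFacts`: Proposition 5.3 (i)–(iv) and the parameter ranges hold for the §7.1 data

The structure `StaircaseFacts` collects the rational inequalities the paper attributes to its
parameter program (Proposition 5.3 (i)–(iv) for the original graded data of the three grades, the
grade ordering (4)/(5), the `δ`-ranges, `ε_{2,1} < S − K`, the region-shape conditions of Corollary
6.4), and `staircaseFacts_hold` proves them in exact arithmetic.

Origin: the verbatim leg `Dhl42/TpY4Dhl42.lean` of the DHL[42,2] certificate package (pub-dhl42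
bundle, archive blob `18cce9e3`; paper snapshot = `paper/main.tex` v1), lines :1158–:1217;
statements and proofs unchanged except: namespace `TpY4Dhl42` →
`Summit.Parity.GeneralizedHardyLittlewood.Theorems.Dhl42`, the package's `simplexSet n B` replaced
by the tree's definitionally equal `Literature.NumberTheory.Sieve.scaledSimplex n B`
(`PolymathBoundedGaps.lean`), docstrings added where missing.

Declarations (2): `StaircaseFacts`, `staircaseFacts_hold`.
-/

namespace Summit.Parity.GeneralizedHardyLittlewood.Theorems.Dhl42

/-- The side conditions of Definition 5.2 and Proposition 5.3(i)-(iv) at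
`k = 42`, `ρ₀ = 10⁻⁵` for the original graded data, plus the parameter
ranges (4) and the region-shape conditions of Corollary 6.4 — the paper's
"rational inequalities verified by the parameter program". -/
structure StaircaseFacts : Prop where
  rho0_pos : 0 < rho0
  /-- Eq. (5): `0 < ϖ₁ < ϖ₂ < ϖ₃ < 1/4`. -/
  grades_order : 0 < varpi1 ∧ varpi1 < varpi2 ∧ varpi2 < varpi3 ∧ varpi3 < 1 / 4
  /-- Eq. (5): `0 < δ_g < 1/4 + ϖ_g`. -/
  delta_range : (0 < delta1 ∧ delta1 < 1 / 4 + varpi1) ∧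
    (0 < delta2 ∧ delta2 < 1 / 4 + varpi2) ∧ (0 < delta3 ∧ delta3 < 1 / 4 + varpi3)
  /-- Corollary 6.4: `max_g ε_{2,g} < S - K`. -/
  eps2_lt_SK : eps2 0 < Sc - Kc
  /-- `0 < ε_{2,3} < ε_{2,2} < ε_{2,1}` (Section 7.1). -/
  eps2_chain : 0 < eps2 2 ∧ eps2 2 < eps2 1 ∧ eps2 1 < eps2 0
  /-- Definition 5.2: positive strictly increasing levels, per grade. -/
  lev_pos : 0 < levAE 0 ∧ 0 < levBE 0 ∧ 0 < levCE 0
  lev_mono : StrictMono levAE ∧ StrictMono levBE ∧ StrictMono levCE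
  /-- Definition 5.2: non-negative thresholds, per grade and side. -/
  tau_nonneg : (∀ j, 0 ≤ tauFA j) ∧ (∀ j, 0 ≤ tauGA j) ∧ (∀ j, 0 ≤ tauFB j) ∧
    (∀ j, 0 ≤ tauGB j) ∧ (∀ j, 0 ≤ tauFC j) ∧ (∀ j, 0 ≤ tauGC j)
  /-- Proposition 5.3(i), an equality by the definition of `ε_{2,g}`. -/
  cond_i : ∀ g : Fin 3, Sc + Kc - Lg g + (2 * 42 + 1) * rho0 ≤ eps2 g
  /-- Proposition 5.3(ii) per grade (`u^g_{J+1} := S + ρ₀` is the last entry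
  of the `levXE` vectors; the numerals `1, 2` are the `i_g` and `86, 87` are
  `2k+1+i_g`). -/
  cond_ii : (∀ j : Fin 22,
      tauFA j + tauGA j ≤ Lg 0 + cg 0 - 1 * levAE j.succ - (2 * 42 + 1 + 1) * rho0 ∨
        (tauFA j < levA j ∧ tauGA j < levA j)) ∧
    (∀ j : Fin 42,
      tauFB j + tauGB j ≤ Lg 1 + cg 1 - 2 * levBE j.succ - (2 * 42 + 1 + 2) * rho0 ∨
        (tauFB j < levB j ∧ tauGB j < levB j)) ∧
    (∀ j : Fin 46,
      tauFC j + tauGC j ≤ Lg 2 + cg 2 - 2 * levCE j.succ - (2 * 42 + 1 + 2) * rho0 ∨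
        (tauFC j < levC j ∧ tauGC j < levC j))
  /-- Proposition 5.3(iii): `u^g_0 ≤ c_g - ρ₀` (an equality). -/
  cond_iii : levAE 0 ≤ cg 0 - rho0 ∧ levBE 0 ≤ cg 1 - rho0 ∧ levCE 0 ≤ cg 2 - rho0
  /-- Proposition 5.3(iv): `2K + (2k-1)ρ₀ < L_1 - ρ₀`. -/
  cond_iv : 2 * Kc + (2 * 42 - 1) * rho0 < Lg 0 - rho0

/-- The Section 7.1 data satisfy `StaircaseFacts`: `ρ₀ > 0`, the grade ordering (4), the `δ`-ranges,
`ε_{2,1} < S − K`, and Proposition 5.3 (i)–(iv) for each of the three grades — every field by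
`norm_num` / `fin_cases` on exact rationals. -/
theorem staircaseFacts_hold : StaircaseFacts where
  rho0_pos := by unfold rho0; norm_num
  grades_order := by unfold varpi1 varpi2 varpi3; norm_num
  delta_range := by unfold delta1 delta2 delta3 varpi1 varpi2 varpi3; norm_num
  eps2_lt_SK := by rw [eps2A_eq]; unfold Sc Kc eps; norm_num
  eps2_chain := ⟨eps2C_pos, eps2_anti.1, eps2_anti.2⟩
  lev_pos := by
    refine ⟨?_, ?_, ?_⟩ <;> norm_num [levAE, levBE, levCE]
  lev_mono := ⟨levAE_strictMono, levBE_strictMono, levCE_strictMono⟩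
  tau_nonneg := ⟨tauFA_nonneg, tauGA_nonneg, tauFB_nonneg, tauGB_nonneg, tauFC_nonneg,
    tauGC_nonneg⟩
  cond_i := fun _ => le_of_eq rfl
  cond_ii := ⟨cond_iiA, cond_iiB, cond_iiC⟩
  cond_iii := by
    refine ⟨?_, ?_, ?_⟩ <;>
      norm_num [levAE, levBE, levCE, cg0_eq, cg1_eq, cg2_eq, rho0]
  cond_iv := by
    rw [Lg0_eq]; unfold Kc eps rho0; norm_num

end Summit.Parity.GeneralizedHardyLittlewood.Theorems.Dhl42
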